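import Summits.Schanuel.Schanuel.Theorems.RootDecomp1KHyperellipticSiegel03

/-!
# RootDecomp1KHyperellipticSiegel — lens 1, generation 62, NODE 23 «HYPERELLIPTIC SIEGEL ON THE K-LINE — the dominant live sector» (Siegel's theorem for y² = f(x), f separable of degree ≥ 3, over any number field — AEC IX.4.3 — PROVED from the tree's unit equation and cubic case; the engine on DOMINANT x-degree-2 pairs c₂x² + c₁x + c₀ (deg c₁, deg c₂ < deg c₀) with separable x-discriminant of degree ≥ 3 ⇒ SiegelClause / LevelFinite / ThinFibreAt ∀ m₀ / BddLevelEmpty, intrinsically the class DomHyper P; the genus-two family M j := x² + 3Y·x + (Y⁵ + 9jY + 9j + 3) decided hypothesis-free ∀ j ∈ ℤ; the territory M_territory incl. 2-adic liveness by size at m₀ = 2; CLAIM L2879, PRICE L2882, K-R54) — continuation (RootDecomp1KHyperellipticSiegel04): §T part 1: numerology of M j (xdeg, natDegree, topX, eTop, thinThreshold), the shape refusals (x-linear / two-term / norm / CB / VW / SW / dsP), presentation_M, the rootless / decided / slope / local / Gauss refusals at m₀ = 2 with GaussAt 3 and thinFibreAt_M_of_three_le by node 15's name, ¬HeightDecidedAt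 2, ¬SepTopAt 2, irreducible_xDisc_M (section Territory, to be continued in part 05)

(lens-1 g62 NODE 23 «HYPERELLIPTIC SIEGEL ON THE K-LINE — the DOMINANT LIVE SECTOR» L2903: HOME kernel K = HOME/decomp-schanuel-lens-1/g62/lean/HyperellipticSiegel.lean sha256 f4b0f073…, 1239 l, 124 theorems + 8 defs, ONE namespace `Summit.Schanuel.Schanuel.Theorems.RootDecomp1KHyperellipticSiegel`, imports the tree port …RootDecomp1KSiegelGenusOne05 ONLY (the PROVED Literature modules Literature.NumberTheory.DiophantineGeometry.{SiegelCubicReduction, UnitEquationFinite, SIntegersFiniteExtension} and EllipticCurves.{KummerSelmerGroupFinite, TwoDescentParity} arrive transitively, BUILT; no …Proofs umbrella, no fact file); no private, no instance, no set_option, no notation, no sorry, no native_decide / decide; farm of record (lens): K rc 0 · 0 errors · 0 sorries, Probe rc 0 (211 `#print axioms` guards, standard triple), Ctrl0 rc 0, Ctrl rc 1 = 42 planted errors exactly; CLAIM L2879, crit g11 PRICE L2882 (PAYABLE THEOREM ×1 EX ANTE for (L)+(E)+(F)+(T) jointly under K-R53 (iii) prong 4; CHECKLIST K-g62 (1)–(11);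 RULE K-R54 PRE-ANNOUNCED), census LIVENESS-v24/v25/v26 (rows M 67 / M 144 / X3; keys hsE / galq / genus_torus of record L2882 / L2893 / L2897), crit g12 RULING L2893 (X3 = standing witness of the dominant-far sector), ADVANCE NOTICE L2901 (a) (engine generality DomZero 2), writer g32/g33 NOTES 14 / 1 / 2 / 4 (pre-kernel arithmetic incl. the real place; X3 certificate; DomHyper flips), critic VERDICT (crit g12): CLEARED — THEOREM ×1 for (L)+(E)+(F)+(T) JOINTLY, ONE credit (K-R53 (iii) prong 4), VERDICT L2907 (crit g12): CHECKLIST K-g62 (1)–(11) met item by item on the critic's own farm runs (K c679d0af… rc 0 · 0 errors · 0 sorries; Probe a3866a38… rc 0 with 211 `#print axioms` guards ⊆ the standard triple; Ctrl0 rc 0; Ctrl rc 1 = exactly the 42 planted errors; L_standalone rc 0 ⇒ §L uses nothing from the K-line); ERRATUM OF RECORD E1 = lens ADDENDUM 1 L2904 (memo only: (E) as typed = node 15's c₀-dominance `DomZero 2` reaches seven tabled LIVENESS rows — M 67, M 144 + the by-product rows contactC / highContactC / quinticP / RC2 / GC2 «reachable, not instantiated»); LABEL OF RECORD: literature KNOWN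 TOOL (Siegel 1926 / LeVeque 1964; AEC IX.4.3; B–G 5.2.1 for U) · tree-NEW PROVED THEOREM · problem-relative NEW LEVER on the K-line (the first genus-≥ 2 class decided; integral-point Siegel consumed directly); TALLY lens-1 ×20 + THEOREM ×22; RULE K-R54 FIXED ((i) toolkit ∪= integral-point Siegel in general = ×0-as-record after node 23; (ii) open territory at m₀ = 2 := K-R53 (ii) territory not reached by (i) ∪ K-R53 (i), two named sectors with standing witnesses W4 (non-dominant) and X3 (dominant-far); (iii) payable clause; (iv) unconditional part ∪= the node-23 tree names after the port); lens DONE L2909; PORT GO L2908 exactly as census STAGING NOTE 13 L2905 (five parts; the one pre-emptive privatisation accepted; chain import as staged). Port by census-1 gen 24 per NODE-g62.md §(11) as `RootDecomp1KHyperellipticSiegel01–05` (`--supports stmt-Schanuel-33364`; the item stays OPEN; no census credit): 01 = §L Siegel's theorem for y² = f(x) in full (sections Parity, Cofactor; `exists_numberField_forall_isSquare_of_even`; `finite_integer_sq_eq_of_unitEquation` with the tree's U-binder verbatim; `finite_integer_sq_eq` unconditional) — the ONLY part whose proofs touch Literature names, all CITED by name (`finite_unitEquation`, `finite_integer_sq_eq_cubic_of_unitEquation`,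 `exists_numberField_forall_mem_selmerGroup_isSquare`, `exists_finite_forall_mem_integer_algebraMap`, `IsDedekindDomain.mk_mem_selmerGroup_iff`, `setOf_valuation_ne_one_finite`, `setOf_one_lt_valuation_finite`), never restated; 02 = §E the engine on dominant x-degree-2 pairs (`pDisc`, `xDisc_xPolyP_two`, `sq_eq_aeval_pDisc`, `den_dvd_of_dyadic`, `badT`, `ordinate_mem_integer`, `fibrePoly_ne_zero`, `finite_ordinates_dom2` … `finite_pointed_levels_dom2`) + §E′ the intrinsic class (`DomHyper`, `domHyper_xPolyP_iff`, `thinFibreAt_of_domHyper`, `levelFinite_of_domHyper`, `siegelClause_of_domHyper`, `bddLevelEmpty_of_domHyper`, …) (section Engine); 03 = §F the family M j (`mQ`, `mC`, `M`, `mD`, `isEisensteinAt_mD`, `domHyper_M`, `levelFinite_M`, `thinFibreAt_M`, `bddLevelEmpty_M`, `siegelClause_M`, `finite_dyadicPoints_M`) (section Family); 04 = §T part 1 (numerology, shape refusals, `presentation_M`, rootless / decided / slope / local / Gauss refusals, `thinFibreAt_M_of_three_le`, `irreducible_xDisc_M`) (section Territory, to be continued); 05 = §T part 2 (the anchor (1,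 −1), odd/tangent-emptiness refusals, real roots, (T-2) `den_pow_five_le_M` / `den_pow_lt_M` / `not_thin_ineq_two_M`, `thinFibreAt_two_iff_levelFinite_M`, `M_territory`, `M'`, `M'_zero` / `M'_one`, `M'_territory`) (section Territory re-opened with K's own open-lines). Text = K VERBATIM (every declaration of K is documented by the lens; statements and proofs unchanged; the module docstring of K kept in part 01 below this provenance block).)
-/

noncomputable section

namespace Summit.Schanuel.Schanuel.Theorems.RootDecomp1KHyperellipticSiegel

open Polynomial IsDedekindDomain NumberField
open scoped Classical WithZero
open Literature.NumberTheory.DiophantineGeometry (finite_integer_sq_eq_cubic_of_unitEquation finite_unitEquation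
  exists_numberField_forall_mem_selmerGroup_isSquare exists_finite_forall_mem_integer_algebraMap)
open IsDedekindDomain.HeightOneSpectrum (setOf_valuation_ne_one_finite setOf_one_lt_valuation_finite)

/-! ### §T  TERRITORY: `M j` IS OUTSIDE EVERY DECIDED CLASS OF RECORD AT `m₀ = 2`, uniformly in `j ∈ ℤ` -/

section Territory

open LiouvilleNumber
open scoped Nat
open Summit.Schanuel.Schanuel.Theorems.RootDecomp1KDegreeLadder
open Summit.Schanuel.Schanuel.Theorems.RootDecomp1KXLinear
open Summit.Schanuel.Schanuel.Theorems.RootDecomp1KXTop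
open Summit.Schanuel.Schanuel.Theorems.RootDecomp1KXAll
open Summit.Schanuel.Schanuel.Theorems.RootDecomp1KLevelFinite
open Summit.Schanuel.Schanuel.Theorems.RootDecomp1KThueMahler
open Summit.Schanuel.Schanuel.Theorems.RootDecomp1KLocalExponent
open Summit.Schanuel.Schanuel.Theorems.RootDecomp1KIntegrality (DomZero GaussAt gaussAt_xPolyP_iff thinFibreAt_of_gaussAt)
open Summit.Schanuel.Schanuel.Theorems.RootDecomp1KSubspaceBranch (SepTopAt)
open Summit.Schanuel.Schanuel.Theorems.RootDecomp1KHeightGrading (BddLevelEmpty bddLevelEmpty_iff_levelFinite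
  HeightDecidedAt)
open Summit.Schanuel.Schanuel.Theorems.RootDecomp1KDescent
open Summit.Schanuel.Schanuel.Theorems.RootDecomp1KCubicDescent
open Summit.Schanuel.Schanuel.Theorems.RootDecomp1KOddEmpty
open Summit.Schanuel.Schanuel.Theorems.RootDecomp1KSiegelGenusOne (SW sC sC_two sC_of_gt S')
open Summit.Schanuel.Schanuel.Theorems.RootDecomp1KTwoBaseCell (psNumer)

/-- `(j : ℤ) (i : ℕ) : xCoeff (M j) i = mC j i`. -/
theorem xCoeff_M (j : ℤ) (i : ℕ) : xCoeff (M j) i = mC j i := by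
  rw [M, xCoeff_xPolyP]
  split_ifs with h
  · rfl
  · exact (mC_of_gt _ (by omega)).symm
/-- `(j : ℤ) : xdeg (M j) = 2`. -/
theorem xdeg_M (j : ℤ) : xdeg (M j) = 2 := by rw [M]; exact xdeg_xPolyP 2 _ (mC_two_ne_zero j)
/-- `(j : ℤ) : topX (M j) = 1` — CONSTANT top (no `ℚ₂`-root, no root at all). -/
theorem topX_M (j : ℤ) : topX (M j) = 1 := by rw [M, topX_xPolyP 2 _ (mC_two_ne_zero j), mC_two]
/-- `(j : ℤ) : 5 ≤ (M j).natDegree`. -/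
theorem five_le_natDegree_M (j : ℤ) : 5 ≤ (M j).natDegree := by
  refine le_natDegree_of_ne_zero fun h => ?_
  have h1 := congrArg (fun q : ℤ[X] => q.coeff 0) h
  simp only [M, coeff_coeff_xPolyP, coeff_zero] at h1
  rw [if_pos (by simp), mC_zero, coeff_mQ_five] at h1
  exact one_ne_zero h1
/-- `(j : ℤ) : (M j).natDegree = 5` — ODD `Y`-degree (REAL-LIVE at every abscissa). -/
theorem natDegree_M (j : ℤ) : (M j).natDegree = 5 := by
  refine le_antisymm ?_ (five_le_natDegree_M j)
  rw [M]
  refine natDegree_xPolyP_le 2 _ 5 fun i hi => ?_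
  interval_cases i
  · rw [mC_zero, natDegree_mQ]
  · rw [mC_one]; exact (natDegree_C_mul_le _ _).trans (by rw [natDegree_X]; norm_num)
  · rw [mC_two, natDegree_one]; norm_num
/-- `(j : ℤ) : M j ≠ 0`. -/
theorem M_ne_zero (j : ℤ) : M j ≠ 0 := fun h => by
  have := five_le_natDegree_M j; rw [h, natDegree_zero] at this; omega
/-- `(j : ℤ) : eTop (M j) = 5` — the top is `5` degrees SHORT of the `Y`-degree (Runge / node 11 / node 12c: `eTop ≤ 1`). -/
theorem eTop_M (j : ℤ) : eTop (M j) = 5 := by rw [eTop, natDegree_M, topX_M, natDegree_one]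
/-- `(j : ℤ) : muTop (M j) = 0`. -/
theorem muTop_M (j : ℤ) : muTop (M j) = 0 := by
  have := muTop_le_natDegree (M j); rw [topX_M, natDegree_one] at this; omega
/-- `(j : ℤ) : thinThreshold (M j) = 6` — the degree ladder decides `M j` only from `m₀ = 6` on. -/
theorem thinThreshold_M (j : ℤ) : thinThreshold (M j) = 6 := by
  rw [thinThreshold, muTop_M, eTop_M]; rfl
/-- `(j : ℤ) : ¬ (M j).natDegree < 2 * xdeg (M j)` — OUTSIDE node 12's height shape (`5 ≥ 4`). -/
theorem not_natDegree_M_lt (j : ℤ) : ¬ (M j).natDegree < 2 * xdeg (M j) := by rw [natDegree_M, xdeg_M]; norm_num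
/-- `(j : ℤ) {m₀ : ℕ} (hm : m₀ ≤ 2) : ¬ HeightDecidedAt m₀ (M j)` — node 12's (conditional) height class refused at `m₀ ≤ 2`. -/
theorem not_heightDecidedAt_M (j : ℤ) {m₀ : ℕ} (hm : m₀ ≤ 2) : ¬ HeightDecidedAt m₀ (M j) := fun h => by
  have := h.2; rw [natDegree_M, xdeg_M] at this; omega
/-- `(j : ℤ) {m₀ : ℕ} (hm : m₀ ≤ 5) : ¬ SepTopAt m₀ (M j)` — node 11's subspace class refused (`eTop = 5`). -/
theorem not_sepTopAt_M (j : ℤ) {m₀ : ℕ} (hm : m₀ ≤ 5) : ¬ SepTopAt m₀ (M j) := fun h => by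
  have := h.2; rw [eTop_M] at this; omega

/-- `M j` has NO x-linear presentation (second `x`-difference of `M j (x, 0) = x² + 9j + 3` is `2 ≠ 0`). -/
theorem M_ne_xLinP (j : ℤ) (A B : ℤ[X]) : M j ≠ xLinP A B := by
  intro hP
  have h := fun x : ℝ => congrArg (fun Q => bev Q x 0) hP
  have h0 := h 0
  have h1 := h 1
  have h2 := h 2
  simp only [bev_M, bev_xLinP] at h0 h1 h2
  have : (2 : ℝ) = 0 := by linear_combination h0 - 2 * h1 + h2
  norm_num at this
/-- `(j : ℤ) : ¬ XLinearLt (M j)`. -/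
theorem not_xLinearLt_M (j : ℤ) : ¬ XLinearLt (M j) := fun ⟨A, B, _, _, hP⟩ => M_ne_xLinP j A B hP
/-- `(j : ℤ) : ¬ XLinTM (M j)` — outside node 16's record class. -/
theorem not_xLinTM_M (j : ℤ) : ¬ XLinTM (M j) := fun ⟨A, B, _, _, _, _, hP⟩ => M_ne_xLinP j A B hP
/-- not a conjugate-poles norm shape of node 10. -/
theorem M_ne_normShapeCurve (j : ℤ) (g q : ℤ[X]) (n : ℕ) (D : ℤ) : M j ≠ normShapeCurve g q n D := by
  rw [normShapeCurve_eq_xLinP]; exact M_ne_xLinP j _ _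
/-- not a two-term curve `x^k·B(Y) − A(Y)` (the `x`-support of `M j` is `{0, 1, 2}`). -/
theorem M_ne_twoTermP (j : ℤ) (k : ℕ) (B A : ℤ[X]) : M j ≠ twoTermP k B A := by
  intro h
  have hc : ∀ i i' : ℕ, (if i' ∈ Finset.range 3 then (mC j i').coeff i else 0) =
      ((if i' = k then B.coeff i else 0) - (if i' = 0 then A.coeff i else 0)) := by
    intro i i'
    rw [← coeff_coeff_xPolyP, ← coeff_coeff_twoTermP, ← h]; rfl
  by_cases hk : k = 1
  · subst hk
    have h02 := hc 0 2
    rw [if_pos (by simp), if_neg (by norm_num), if_neg (by norm_num), mC_two, coeff_one_zero] at h02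
    norm_num at h02
  · have h11 := hc 1 1
    rw [if_pos (by simp), if_neg (fun h => hk h.symm), if_neg (by norm_num), mC_one, coeff_C_mul_X] at h11
    norm_num at h11
/-- not a cubic-descent curve of node 20 (`[Y⁵]c₀`: `1` versus `0`). -/
theorem M_ne_CB (j h₁ h₀ l₁ l₀ : ℤ) : M j ≠ CB h₁ h₀ l₁ l₀ := by
  intro h
  have h1 : (xCoeff (M j) 0).coeff 5 = (xCoeff (CB h₁ h₀ l₁ l₀) 0).coeff 5 := by rw [h]
  rw [xCoeff_M, mC_zero, coeff_mQ_five, xCoeff_CB, cbC_zero, coeff_neg, cbH] at h1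
  simp only [coeff_add, coeff_X_pow, coeff_C_mul_X, coeff_C] at h1
  norm_num at h1
/-- not in node 21's family `VW l` (`c₂`: `1` versus `Y⁴ − 17`). -/
theorem M_ne_VW (j l : ℤ) : M j ≠ VW l := by
  intro h
  have h1 : (xCoeff (M j) 2).coeff 4 = (xCoeff (VW l) 2).coeff 4 := by rw [h]
  rw [xCoeff_M, mC_two, xCoeff_VW, vC_two, coeff_vQ_four, coeff_one] at h1
  norm_num at h1
/-- not in node 22's class `SW e` (`c₂`: `1` versus `Y⁴ − 17`) — in particular not `S' j'`. -/
theorem M_ne_SW (j e : ℤ) : M j ≠ SW e := by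
  intro h
  have h1 : xCoeff (M j) 2 = xCoeff (SW e) 2 := by rw [h]
  rw [xCoeff_M, mC_two, SW, xCoeff_xPolyP, if_pos le_rfl, sC_two] at h1
  exact vQ_ne_zero (by
    have h4 := congrArg (fun q : ℤ[X] => q.coeff 4) h1
    simp only [coeff_one, coeff_vQ_four] at h4
    norm_num at h4)
/-- not a descent curve `dsP Q A = Q·x² + 2A·x + A` of node 19 (`c₁ = 2c₀` fails: `[Y⁵]`: `0` versus `2`). -/
theorem M_ne_dsP (j : ℤ) (Q A : ℤ[X]) : M j ≠ dsP Q A := by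
  intro h
  have h0 : xCoeff (M j) 0 = xCoeff (dsP Q A) 0 := by rw [h]
  have h1 : xCoeff (M j) 1 = xCoeff (dsP Q A) 1 := by rw [h]
  rw [xCoeff_M, mC_zero, dsP, xCoeff_xPolyP, if_pos (by norm_num), dsC_zero] at h0
  rw [xCoeff_M, mC_one, dsP, xCoeff_xPolyP, if_pos (by norm_num), dsC_one, ← h0] at h1
  have h5 := congrArg (fun q : ℤ[X] => q.coeff 5) h1
  simp only [coeff_C_mul_X, coeff_ofNat_mul, coeff_mQ_five] at h5
  norm_num at h5

/-- in a presentation `M j = xPolyP k c` with `c k ≠ 0`: `k = 2`, `c 0 = Q_j`, `c 2 = 1`. -/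
theorem presentation_M {j : ℤ} {k : ℕ} {c : ℕ → ℤ[X]} (hck : c k ≠ 0) (h : M j = xPolyP k c) :
    k = 2 ∧ c 0 = mQ j ∧ c 2 = 1 := by
  have hk : k = 2 := by have := xdeg_xPolyP k c hck; rw [← h, xdeg_M] at this; exact this.symm
  subst hk
  have h0 := xCoeff_xPolyP 2 c 0
  have h2 := xCoeff_xPolyP 2 c 2
  rw [← h, xCoeff_M, if_pos (by norm_num)] at h0 h2
  rw [mC_zero] at h0
  rw [mC_two] at h2
  exact ⟨rfl, h0.symm, h2.symm⟩
/-- `(j : ℤ) {e : ℕ} (he : e ≤ 4) : ¬ RootlessTop e (M j)` — node 13's class needs `deg c₀ ≤ deg c₂ + e`, i.e. `e ≥ 5`. -/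
theorem not_rootlessTop_M (j : ℤ) {e : ℕ} (he : e ≤ 4) : ¬ RootlessTop e (M j) := by
  rintro ⟨k, c, hord, hroot, hP⟩
  by_cases hck : c k = 0
  · exact hroot 0 (by rw [hck, map_zero])
  obtain ⟨rfl, hc0, hc2⟩ := presentation_M hck hP
  have := hord 0 (by norm_num)
  rw [hc0, hc2, natDegree_mQ, natDegree_one] at this
  omega
/-- … while `RootlessTop 5 (M j)` HOLDS (honest: node 13 decides `M j` at `m₀ ≥ 6` = the degree ladder's threshold). -/
theorem rootlessTop_five_M (j : ℤ) : RootlessTop 5 (M j) :=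
  ⟨2, mC j, fun i hi => by
    interval_cases i
    · rw [mC_zero, mC_two, natDegree_mQ, natDegree_one]
    · rw [mC_one, mC_two, natDegree_one]
      exact (natDegree_C_mul_le _ _).trans (by rw [natDegree_X]; norm_num),
    fun z => by rw [mC_two, map_one]; exact one_ne_zero, rfl⟩
/-- **`¬ DecidedAt m₀ (M j)` for `m₀ ≤ 5`** — each of the five disjuncts of the record's decided class refuted. -/
theorem not_decidedAt_M (j : ℤ) {m₀ : ℕ} (hm : m₀ ≤ 5) : ¬ DecidedAt m₀ (M j) := by
  rintro (h | h | h | h | h)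
  · rw [natDegree_M] at h; omega
  · exact not_xLinearLt_M j h
  · obtain ⟨-, A, B, -, hP⟩ := h; exact M_ne_xLinP j A B hP
  · rw [thinThreshold_M] at h; omega
  · exact not_rootlessTop_M j (by omega) h
/-- `¬ SlopeCond m₀ 2 (mC j)` for `m₀ ≤ 2` (`deg c₀ − deg c₂ = 5 ≥ 2·m₀`): node 15's slope condition FAILS at `m₀ = 2`. -/
theorem not_slopeCond_mC (j : ℤ) {m₀ : ℕ} (hm : m₀ ≤ 2) : ¬ SlopeCond m₀ 2 (mC j) := fun hS => by
  have := hS 0 (by norm_num) (by rw [mC_zero, mC_two, natDegree_mQ, natDegree_one]; norm_num)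
  rw [mC_zero, mC_two, natDegree_mQ, natDegree_one] at this
  omega
/-- `SlopeCond m₀ 2 (mC j)` for `3 ≤ m₀`. -/
theorem slopeCond_mC (j : ℤ) {m₀ : ℕ} (hm : 3 ≤ m₀) : SlopeCond m₀ 2 (mC j) := by
  intro i hi _
  interval_cases i
  · rw [mC_zero, mC_two, natDegree_mQ, natDegree_one]; omega
  · rw [mC_one, mC_two, natDegree_one]
    exact lt_of_le_of_lt (Nat.sub_le _ _) (lt_of_le_of_lt (natDegree_C_mul_le _ _) (by rw [natDegree_X]; omega))
/-- **`¬ LocalAt m₀ (M j)` for `m₀ ≤ 2`** — node 14 refused (slope condition). -/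
theorem not_localAt_M (j : ℤ) {m₀ : ℕ} (hm : m₀ ≤ 2) : ¬ LocalAt m₀ (M j) := by
  rintro ⟨k, c, hck, hP, -, hS⟩
  obtain ⟨rfl, hc0, hc2⟩ := presentation_M hck hP
  have := hS 0 (by norm_num) (by rw [hc0, hc2, natDegree_mQ, natDegree_one]; norm_num)
  rw [hc0, hc2, natDegree_mQ, natDegree_one] at this
  omega
/-- **`¬ GaussAt m₀ (M j)` for `m₀ ≤ 2`** — node 15 refused AT THE RESIDUAL QUALITY (dominance holds, slope fails). -/
theorem not_gaussAt_M (j : ℤ) {m₀ : ℕ} (hm : m₀ ≤ 2) : ¬ GaussAt m₀ (M j) := fun h => by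
  rw [M] at h
  exact not_slopeCond_mC j hm ((gaussAt_xPolyP_iff 2 (mC j) (mC_two_ne_zero j)).mp h).2
/-- … while `GaussAt m₀ (M j)` HOLDS for `3 ≤ m₀` (honest: node 15 decides `M j` at every `m₀ ≥ 3`). -/
theorem gaussAt_M (j : ℤ) {m₀ : ℕ} (hm : 3 ≤ m₀) : GaussAt m₀ (M j) := by
  rw [M]; exact (gaussAt_xPolyP_iff 2 (mC j) (mC_two_ne_zero j)).mpr ⟨domZero_mC j, slopeCond_mC j hm⟩
/-- `ThinFibreAt m₀ (M j)` for `3 ≤ m₀` BY NODE 15 (one line; the residual quality `m₀ = 2` is NOT so reached). -/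
theorem thinFibreAt_M_of_three_le (j : ℤ) {m₀ : ℕ} (hm : 3 ≤ m₀) : ThinFibreAt m₀ (M j) :=
  thinFibreAt_of_gaussAt (gaussAt_M j hm)

/-- **THE `x`-DISCRIMINANT OF `M j` IS A ℚ-IRREDUCIBLE QUINTIC** (GENUS TWO; no rational Weierstrass point: no
2-descent datum; `5 ≢ 0 (mod 4)`: NOT node 22's genus-one quartic key). -/
theorem irreducible_xDisc_M (j : ℤ) :
    Irreducible ((xDisc (M j)).map (Int.castRingHom ℚ)) ∧ (xDisc (M j)).natDegree = 5 := by
  rw [xDisc_M, natDegree_mD]; exact ⟨irreducible_mD_rat j, rfl⟩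

end Territory

end Summit.Schanuel.Schanuel.Theorems.RootDecomp1KHyperellipticSiegel

end
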